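import Summits.Ventures.HodgeRepro2.T7SupportBergmanTorusOrbital
import Summits.Ventures.HodgeRepro2.T5BergmanMonomialNorm
import Summits.Ventures.HodgeRepro2.T5BergmanCoefficientL2

/-!
# The orbital integral for a conjugate second torus, and its value at `γ = h⁻¹` (support, seat p1)

The companion of `T7SupportBergmanTorusOrbital` for the two tori `T_A = K` (the rotation torus) and
`T_B = h K h⁻¹` (`h ∈ SU(1,1)`), with the `T_B`-weight vector `π_k(h) zʲ` on the right and the `T_A`-weight
vector `zⁿ` on the left: the orbital integral of `γ` is the `K × K` one of `γ h`,

  `∫_K ∫_K ⟨π_k(rot u · γ · h rot v h⁻¹) π_k(h) zʲ, zⁿ⟩_k · u^p · conj(v^q) = [p = k + 2n] · [q = −(k + 2j)] · ⟨π_k(γ h) zʲ, zⁿ⟩_k`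

(`torus_orbital_conj_eq`), so at `γ = h⁻¹` it is `[…] · ⟨zʲ, zⁿ⟩_k` (`torus_orbital_conj_at_inv`), which for
`j = n` and matching characters is `‖zⁿ‖²_k ≠ 0` (`torus_orbital_conj_at_inv_ne_zero`): the bi-period
«equals `‖u_A‖² ≠ 0` at `γ = h⁻¹`» of the line's archimedean analysis, in the explicit model.

Explicit model only; nothing about the adelic group, the actual tori, or any period.
Blind lane: Mathlib + the HodgeRepro2 prefix only; no sorry; axioms ⊆ {propext, Classical.choice, Quot.sound}.
-/

namespace Summit.Ventures.HodgeRepro2.T7SupportBergmanConjTorus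

open MeasureTheory
open T5SU11Unimodular T5SU11Fibration T5BergmanCoefficient T5BergmanMatrixCoeff T5HaarCircle
  T7SupportBergmanTorusOrbital

variable [MeasurableSpace Circle] [BorelSpace Circle]

omit [MeasurableSpace Circle] [BorelSpace Circle] in
/-- the coefficient of `π_k(h) f` at `x` is the coefficient of `f` at `x h` -/
theorem matrixCoeff_act_left (k : ℕ) (f g : ℂ → ℂ) (h x : SU11) :
    matrixCoeff k (act k h f) g x = matrixCoeff k f g (x * h) :=
  (matrixCoeff_mul k f g x h).symm

omit [MeasurableSpace Circle] [BorelSpace Circle] in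
/-- the group identity behind the conjugate torus -/
theorem conj_torus_mul (u v : Circle) (γ h : SU11) :
    rot u * γ * (h * rot v * h⁻¹) * h = rot u * (γ * h) * rot v := by
  group

/-- **the orbital integral for `T_A = K`, `T_B = h K h⁻¹`** is the `K × K` orbital integral of `γ h`. -/
theorem torus_orbital_conj_eq (k j n : ℕ) (hk : 2 ≤ k) (h γ : SU11) (p q : ℤ) :
    ∫ u : Circle, ∫ v : Circle,
        matrixCoeff k (act k h (fun w => w ^ j)) (fun w => w ^ n) (rot u * γ * (h * rot v * h⁻¹)) *
          ((u : ℂ) ^ p * (starRingEnd ℂ) ((v : ℂ) ^ q)) ∂haarCircle ∂haarCircle =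
      (if p = ((k + 2 * n : ℕ) : ℤ) then 1 else 0) * (if (-(k + 2 * j : ℕ) : ℤ) = q then 1 else 0) *
        matrixCoeff k (fun w => w ^ j) (fun w => w ^ n) (γ * h) := by
  have e : ∀ (u v : Circle),
      matrixCoeff k (act k h (fun w => w ^ j)) (fun w => w ^ n) (rot u * γ * (h * rot v * h⁻¹)) =
      matrixCoeff k (fun w => w ^ j) (fun w => w ^ n) (rot u * (γ * h) * rot v) := by
    intro u v
    rw [matrixCoeff_act_left, conj_torus_mul]
  simp_rw [e]
  exact torus_orbital_eq k j n hk (γ * h) p q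

/-- **the value at `γ = h⁻¹`**: the orbital integral is `[…] · ⟨zʲ, zⁿ⟩_k`. -/
theorem torus_orbital_conj_at_inv (k j n : ℕ) (hk : 2 ≤ k) (h : SU11) (p q : ℤ) :
    ∫ u : Circle, ∫ v : Circle,
        matrixCoeff k (act k h (fun w => w ^ j)) (fun w => w ^ n) (rot u * h⁻¹ * (h * rot v * h⁻¹)) *
          ((u : ℂ) ^ p * (starRingEnd ℂ) ((v : ℂ) ^ q)) ∂haarCircle ∂haarCircle =
      (if p = ((k + 2 * n : ℕ) : ℤ) then 1 else 0) * (if (-(k + 2 * j : ℕ) : ℤ) = q then 1 else 0) *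
        pairing k (fun w => w ^ j) (fun w => w ^ n) := by
  rw [torus_orbital_conj_eq k j n hk h h⁻¹ p q, inv_mul_cancel]
  congr 1
  unfold matrixCoeff
  congr 1
  funext z
  exact act_one k _ z

/-- **`‖u_A‖² ≠ 0`**: for `j = n` and matching characters (`p = k + 2n`, `q = −(k + 2n)`) the orbital integral at
`γ = h⁻¹` is `‖zⁿ‖²_k`, a positive real. -/
theorem torus_orbital_conj_at_inv_ne_zero (k n : ℕ) (hk : 2 ≤ k) (h : SU11) :
    ∫ u : Circle, ∫ v : Circle,
        matrixCoeff k (act k h (fun w => w ^ n)) (fun w => w ^ n) (rot u * h⁻¹ * (h * rot v * h⁻¹)) *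
          ((u : ℂ) ^ ((k + 2 * n : ℕ) : ℤ) * (starRingEnd ℂ) ((v : ℂ) ^ (-(k + 2 * n : ℕ) : ℤ)))
          ∂haarCircle ∂haarCircle ≠ 0 := by
  rw [torus_orbital_conj_at_inv k n n hk h, if_pos rfl, if_pos rfl, one_mul, one_mul]
  intro h0
  have := T5BergmanMonomialNorm.pairing_monomial_self_pos k hk n
  rw [h0, Complex.zero_re] at this
  exact lt_irrefl _ this

end Summit.Ventures.HodgeRepro2.T7SupportBergmanConjTorus
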